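import Summits.MatrixMultiplication.OmegaCensus.SmallFormats.MatMul228GF3CoverSpec
import Summits.MatrixMultiplication.OmegaCensus.SmallFormats.MatMul228GF3CoverRunsS
import Summits.MatrixMultiplication.OmegaCensus.SmallFormats.MatMul228GF3CoverK8
import Summits.MatrixMultiplication.OmegaCensus.SmallFormats.MatMul228GF3CoverN8
import Summits.MatrixMultiplication.OmegaCensus.SmallFormats.MatMul228GF3Funnel
import Summits.MatrixMultiplication.OmegaCensus.SmallFormats.MatMul227GF3Enumeration
import HarnessLib

/-!
# ω-census family (a): **`R_𝔽₃(⟨2,2,8⟩) = 28` conditional ONLY on the exclusion of 15 explicit marginals** — the `(8,27)` cover certificate assembled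

Cell `pub-omega` (unit `pub-omega-tensor`, gen 41), topic `Summits/MatrixMultiplication/OmegaCensus` (sub-folder
`SmallFormats`). Framing (verbatim): lottery ticket; floor = certified bounds/negative ranges. HONEST FRAMING: a CONDITIONAL census statement for
the small format `⟨2,2,8⟩` over `𝔽₃`: the ENUMERATION side of tensor g39's reading «R_𝔽₃(⟨2,2,8⟩) = 28 ⟺ none of K1–K15 is the X-marginal of a
27-term scheme» (ALL4-SAT-g39 §1) is now a KERNEL theorem; the EXCLUSION of the 15 representatives is NOT proved anywhere in the tree (it is the
hypothesis `hexcl`). Nothing here is a bound on `ω`; no sentence here is «R_𝔽₃(⟨2,2,8⟩) = 28».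

Assembly: the funnel at `(8,27)` (`Enum723.tensorRank_228_gf3_eq_of_noLoadedPlane`, p730384) + the loaded-branch clause system `Cover827.Adm827`
(`cnt_clauses` with the half law plus one `C = 9`, digit cap, tensor g38's loaded-plane clause p726621) + the COVER certificate
(`Cover827.cover827_of_covers` with the kernel replays `runNb`, `runG8`, `runT8`, `runD8`, `runK8_*` (1785 leaves), `runN8_*` (5672 leaves) of the
LP-guided branch-and-bound trees with bound tightening, kit  of tensor g41) + `inOrbit_of_cnt_eq` / `inOrbit_moveW` /
`exists_xMarginal_eq_of_inOrbit`. Main statement: `tensorRank_228_gf3_eq_of_exclusion`.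
-/

namespace Summit.MatrixMultiplication.OmegaCensus.SmallFormats.Cover827

open Finset Matrix Enum723 BoxCover Cover930
open Literature.Computability.AlgebraicComplexity
open Summit.MatrixMultiplication.OmegaCensus.RankOnePlaneCapGeneral

set_option maxRecDepth 4000

/-! ## The kernel replays give the covering hypotheses -/

set_option maxRecDepth 100000 in
set_option maxHeartbeats 400000000 in
/-- The solution certificates are well-formed: representative index `< 15`, word in the generators, and the word reproduces the vector. -/
theorem certs827_facts : (∀ e ∈ certsNa, e.2.1 < 15 ∧ WordOK e.2.2 ∧ actW e.2.2 (rep827cL.getD e.2.1 []) = e.1) ∧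
    (∀ e ∈ certsK8, e.2.1 < 15 ∧ WordOK e.2.2 ∧ actW e.2.2 (rep827cL.getD e.2.1 []) = e.1) := by
  constructor <;> decide +kernel

/-- Case `Nb` is covered (no solutions). -/
theorem coversNb : Covers rowsNb [] 40 lo0 hi3 := covers_of_chk (by decide) (by decide) runNb

/-- Case `γ` is covered (no solutions). -/
theorem coversG8 : Covers rowsA8 [] 40 loG hiG := covers_of_chk (by decide) (by decide) runG8

/-- Case `τ` is covered (no solutions). -/
theorem coversT8 : Covers rowsA8 [] 40 loT hiT := covers_of_chk (by decide) (by decide) runT8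

/-- Case `δ` is covered (no solutions). -/
theorem coversD8 : Covers rowsA8 [] 40 lo0 hiD := covers_of_chk (by decide) (by decide) runD8

/-- **The cover theorem at `(8,27)`**: every admissible count vector of the loaded branch is a group image of one of `cnt K1, …, cnt K15`. -/
theorem cover827 (c : ℕ → ℕ) (h : Adm827 c) : ∃ j, j < 15 ∧ ∃ w, WordOK w ∧ Eq40 c (actWS w (repv827 j)) :=
  cover827_of_covers certs827_facts.1 certs827_facts.2 coversN8 coversNb coversK8 coversG8 coversT8 coversD8 c h

/-! ## The fifteen representatives -/

/-- The representatives `K1–K15` as marginals: term `i` of `Kⱼ₊₁` is the class matrix of entry `i` of `repCls827L[j]`. -/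
def REP827 (j : ℕ) : Fin 27 → Matrix (Fin 2) (Fin 2) (ZMod 3) := fun i => clsM ((repCls827L.getD j []).getD i 0)

/-- The class lists list classes. -/
theorem repCls827L_lt : ∀ j, j < 15 → ∀ i, i < 27 → (repCls827L.getD j []).getD i 0 < 40 := by decide

set_option maxHeartbeats 400000000 in
/-- The representatives have the tabulated count vectors. -/
theorem cnt_REP827 : ∀ j, j < 15 → ∀ b, b < 40 →
    (Finset.univ.filter fun i : Fin 27 => IsCls (clsF ((repCls827L.getD j []).getD i 0)) b).card = (rep827cL.getD j []).getD b 0 := by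
  decide +kernel

/-- The representatives are nowhere zero and have the tabulated count vectors. -/
theorem REP827_facts : ∀ j, j < 15 → (∀ i, REP827 j i ≠ 0) ∧ Eq40 (cnt (REP827 j)) (repv827 j) := by
  intro j hj
  refine ⟨fun i h0 => ?_, fun b hb => ?_⟩
  · have h1 := isCls_nonzero (clsF _) _ (repCls827L_lt j hj i i.isLt) (Or.inl rfl)
    rw [← mflat_clsM, show clsM ((repCls827L.getD j []).getD (↑i) 0) = REP827 j i from rfl, h0] at h1
    exact absurd h1 (by decide)
  · rw [repv827, ← cnt_REP827 j hj b hb, cnt]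
    rfl

/-! ## The conditional rank statement -/

/-- The count vector of a `27`-term computation in the loaded branch is admissible for `Adm827`. -/
theorem adm827_cnt (β : BilinComp (mulBilin (ZMod 3) 2 2 8) (Fin 27))
    (hload : 11 ≤ ∑ a ∈ Finset.Ico 24 40, cnt (xMarginal β) a ∧ (∃ k, 32 ≤ k ∧ k < 36 ∧ 3 ≤ load (cnt (xMarginal β)) k) ∧
      (∃ k, 36 ≤ k ∧ k < 40 ∧ 3 ≤ load (cnt (xMarginal β)) k) ∧ ∀ k, 32 ≤ k → k < 40 → load (cnt (xMarginal β)) k ≤ 4) :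
    Adm827 (cnt (xMarginal β)) := by
  classical
  have hr : 27 ≤ tensorRank (matMulTensor (ZMod 3) 2 2 8) := by
    have h := (tensorRank_matMulTensor_22n_gf3_window 8 (by norm_num)).1
    have h' : max (3 * 8 + 2) ((36 * 8 + 10) / 11) = 27 := by norm_num
    omega
  have hm := xMarginal_ne_zero_of_le_tensorRank hr β
  obtain ⟨hJ, -, hQ, hL, ht⟩ := cnt_clauses (C := 9) (xMarginal β) hm (xCaps3_xMarginal β) fun X₀ hX₀ => by
    have h := invLineCapHalfPlus_xMarginal (n := 8) (by norm_num) β X₀ hX₀; omega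
  obtain ⟨hσ, -, -, h4⟩ := hload
  refine ⟨fun k hk => ?_, fun a ha => by have := cnt_add_three_mul_le β a ha; omega, ht, hσ, fun k hk1 hk2 h3 => ?_⟩
  · rw [cap827_eq k hk]
    by_cases h1 : k < 32
    · rw [if_pos h1]; have := hJ k h1; omega
    rw [if_neg h1]
    by_cases h2 : k < 40
    · rw [if_pos h2]; exact h4 k (by omega) h2
    rw [if_neg h2]
    by_cases h3 : k < 58
    · rw [if_pos h3]; have := hQ k (by omega) h3; omega
    · rw [if_neg h3]; exact hL k (by omega) hk
  · have := loaded_plane_clause (n := 8) (by norm_num) β hm k hk1 hk2 h3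
    simp only [acnt]; omega

/-- **`R_𝔽₃(⟨2,2,8⟩) = 28` CONDITIONAL ONLY ON THE EXCLUSION OF THE FIFTEEN REPRESENTATIVES.** IF none of
* `K1` = !![1, 0; 2, 1], !![0, 1; 1, 2], !![1, 0; 1, 1], !![0, 1; 2, 0], !![1, 1; 0, 2], !![1, 2; 2, 2], !![0, 1; 2, 1], !![1, 0; 2, 2], !![1, 1; 2, 1], !![1, 2; 1, 0], !![1, 0; 0, 2], !![1, 0; 0, 0], !![0, 1; 0, 0], !![1, 1; 0, 0], !![1, 2; 0, 0], !![0, 0; 1, 0], !![0, 0; 0, 1], !![0, 0; 1, 1], !![0, 0; 1, 2], !![1, 0; 1, 0], !![0, 1; 0, 1], !![1, 1; 1, 1], !![1, 2; 1, 2], !![1, 0; 2, 0], !![0, 1; 0, 2], !![1, 1; 2, 2], !![1, 2; 2, 1]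
* `K2` = !![1, 2; 1, 1], !![1, 0; 2, 1], !![1, 2; 0, 2], !![1, 0; 1, 1], !![1, 1; 0, 2], !![1, 2; 2, 2], !![1, 0; 1, 2], !![0, 1; 2, 1], !![1, 0; 2, 2], !![1, 1; 2, 1], !![1, 2; 1, 0], !![1, 0; 0, 0], !![0, 1; 0, 0], !![1, 1; 0, 0], !![1, 2; 0, 0], !![0, 0; 1, 0], !![0, 0; 0, 1], !![0, 0; 1, 1], !![0, 0; 1, 2], !![1, 0; 1, 0], !![0, 1; 0, 1], !![1, 1; 1, 1], !![1, 2; 1, 2], !![1, 0; 2, 0], !![0, 1; 0, 2], !![1, 1; 2, 2], !![1, 2; 2, 1]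
* `K3` = !![1, 1; 0, 1], !![1, 0; 2, 1], !![1, 1; 2, 0], !![1, 0; 1, 1], !![1, 0; 1, 2], !![0, 1; 2, 1], !![1, 1; 1, 0], !![1, 2; 0, 1], !![0, 1; 2, 2], !![1, 1; 2, 1], !![1, 2; 1, 0], !![1, 0; 0, 0], !![0, 1; 0, 0], !![1, 1; 0, 0], !![1, 2; 0, 0], !![0, 0; 1, 0], !![0, 0; 0, 1], !![0, 0; 1, 1], !![0, 0; 1, 2], !![1, 0; 1, 0], !![0, 1; 0, 1], !![1, 1; 1, 1], !![1, 2; 1, 2], !![1, 0; 2, 0], !![0, 1; 0, 2], !![1, 1; 2, 2], !![1, 2; 2, 1]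
* `K4` = !![1, 2; 2, 0], !![1, 2; 1, 1], !![1, 1; 2, 0], !![1, 2; 0, 2], !![1, 0; 1, 1], !![1, 1; 0, 2], !![1, 2; 2, 2], !![1, 1; 1, 0], !![1, 0; 2, 2], !![1, 2; 1, 0], !![1, 0; 0, 2], !![1, 0; 0, 0], !![1, 1; 0, 0], !![1, 2; 0, 0], !![1, 2; 0, 0], !![0, 0; 1, 0], !![0, 0; 0, 1], !![0, 0; 0, 1], !![0, 0; 1, 1], !![1, 0; 1, 0], !![0, 1; 0, 1], !![1, 1; 1, 1], !![1, 2; 1, 2], !![1, 0; 2, 0], !![0, 1; 0, 2], !![1, 1; 2, 2], !![1, 2; 2, 1]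
* `K5` = !![1, 2; 1, 1], !![1, 0; 2, 1], !![0, 1; 1, 2], !![1, 2; 0, 2], !![1, 0; 1, 1], !![1, 0; 1, 2], !![0, 1; 2, 1], !![1, 2; 0, 1], !![1, 0; 2, 2], !![0, 1; 2, 2], !![1, 1; 2, 1], !![1, 2; 1, 0], !![1, 0; 0, 0], !![0, 1; 0, 0], !![1, 1; 0, 0], !![0, 0; 1, 0], !![0, 0; 0, 1], !![0, 0; 1, 1], !![0, 0; 1, 2], !![1, 0; 1, 0], !![0, 1; 0, 1], !![1, 1; 1, 1], !![1, 2; 1, 2], !![1, 0; 2, 0], !![0, 1; 0, 2], !![1, 1; 2, 2], !![1, 2; 2, 1]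
* `K6` = !![1, 2; 2, 0], !![1, 0; 2, 1], !![1, 1; 2, 0], !![1, 2; 0, 2], !![1, 0; 1, 1], !![1, 2; 2, 2], !![1, 0; 1, 2], !![0, 1; 2, 1], !![1, 1; 1, 0], !![1, 0; 2, 2], !![1, 1; 2, 1], !![1, 2; 1, 0], !![1, 0; 0, 0], !![0, 1; 0, 0], !![1, 1; 0, 0], !![1, 2; 0, 0], !![0, 0; 1, 0], !![0, 0; 0, 1], !![0, 0; 1, 1], !![0, 0; 1, 2], !![1, 0; 1, 0], !![0, 1; 0, 1], !![1, 1; 1, 1], !![1, 2; 1, 2], !![1, 0; 2, 0], !![1, 1; 2, 2], !![1, 2; 2, 1]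
* `K7` = !![1, 1; 0, 1], !![1, 2; 1, 1], !![1, 0; 2, 1], !![1, 1; 2, 0], !![1, 2; 0, 2], !![1, 0; 1, 1], !![1, 1; 1, 0], !![1, 2; 0, 1], !![1, 0; 2, 2], !![1, 1; 2, 1], !![1, 2; 1, 0], !![1, 0; 0, 2], !![1, 0; 0, 0], !![0, 1; 0, 0], !![1, 1; 0, 0], !![1, 2; 0, 0], !![0, 0; 1, 0], !![0, 0; 0, 1], !![0, 0; 1, 1], !![0, 0; 1, 2], !![1, 0; 1, 0], !![0, 1; 0, 1], !![1, 1; 1, 1], !![1, 2; 1, 2], !![1, 0; 2, 0], !![0, 1; 0, 2], !![1, 1; 2, 2]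
* `K8` = !![1, 2; 2, 0], !![1, 0; 2, 1], !![1, 2; 0, 2], !![1, 0; 1, 1], !![0, 1; 2, 0], !![1, 2; 2, 2], !![1, 0; 1, 2], !![0, 1; 2, 1], !![1, 1; 1, 0], !![1, 1; 2, 1], !![1, 2; 1, 0], !![1, 0; 0, 2], !![1, 0; 0, 0], !![0, 1; 0, 0], !![1, 1; 0, 0], !![1, 2; 0, 0], !![0, 0; 1, 0], !![0, 0; 0, 1], !![0, 0; 1, 1], !![0, 0; 1, 2], !![0, 1; 0, 1], !![1, 1; 1, 1], !![1, 2; 1, 2], !![1, 0; 2, 0], !![0, 1; 0, 2], !![1, 1; 2, 2], !![1, 2; 2, 1]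
* `K9` = !![1, 2; 2, 0], !![1, 0; 2, 1], !![0, 1; 1, 2], !![1, 1; 2, 0], !![1, 0; 1, 1], !![0, 1; 2, 0], !![1, 1; 0, 2], !![1, 1; 1, 0], !![1, 2; 0, 1], !![1, 0; 2, 2], !![0, 1; 2, 2], !![1, 0; 0, 2], !![1, 0; 0, 0], !![0, 1; 0, 0], !![1, 1; 0, 0], !![1, 2; 0, 0], !![0, 0; 1, 0], !![0, 0; 0, 1], !![0, 0; 1, 1], !![0, 0; 1, 2], !![1, 0; 1, 0], !![0, 1; 0, 1], !![1, 2; 1, 2], !![1, 0; 2, 0], !![1, 1; 2, 2], !![1, 1; 2, 2], !![1, 2; 2, 1]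
* `K10` = !![1, 2; 2, 0], !![1, 2; 1, 1], !![1, 0; 2, 1], !![0, 1; 1, 2], !![1, 0; 1, 1], !![0, 1; 2, 0], !![1, 0; 1, 2], !![0, 1; 2, 1], !![1, 2; 0, 1], !![0, 1; 2, 2], !![1, 2; 1, 0], !![1, 0; 0, 2], !![1, 0; 0, 0], !![0, 1; 0, 0], !![1, 1; 0, 0], !![1, 2; 0, 0], !![0, 0; 1, 0], !![0, 0; 1, 1], !![0, 0; 1, 1], !![0, 0; 1, 2], !![1, 0; 1, 0], !![0, 1; 0, 1], !![1, 2; 1, 2], !![1, 0; 2, 0], !![0, 1; 0, 2], !![1, 1; 2, 2], !![1, 2; 2, 1]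
* `K11` = !![1, 2; 2, 0], !![1, 2; 1, 1], !![1, 1; 2, 0], !![1, 0; 1, 1], !![0, 1; 2, 0], !![1, 1; 0, 2], !![1, 1; 1, 0], !![1, 2; 0, 1], !![1, 0; 2, 2], !![0, 1; 2, 2], !![1, 2; 1, 0], !![1, 0; 0, 2], !![0, 1; 0, 0], !![1, 1; 0, 0], !![1, 2; 0, 0], !![1, 2; 0, 0], !![0, 0; 1, 0], !![0, 0; 0, 1], !![0, 0; 1, 1], !![0, 0; 1, 2], !![1, 0; 1, 0], !![1, 0; 1, 0], !![0, 1; 0, 1], !![1, 2; 1, 2], !![1, 0; 2, 0], !![0, 1; 0, 2], !![1, 1; 2, 2]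
* `K12` = !![1, 2; 2, 0], !![1, 2; 1, 1], !![1, 0; 2, 1], !![0, 1; 1, 2], !![1, 0; 1, 1], !![0, 1; 2, 0], !![1, 0; 1, 2], !![1, 2; 0, 1], !![1, 0; 2, 2], !![0, 1; 2, 2], !![1, 2; 1, 0], !![1, 0; 0, 2], !![1, 0; 0, 0], !![0, 1; 0, 0], !![1, 1; 0, 0], !![1, 2; 0, 0], !![0, 0; 0, 1], !![0, 0; 1, 1], !![0, 0; 1, 1], !![0, 0; 1, 2], !![1, 0; 1, 0], !![1, 0; 1, 0], !![0, 1; 0, 1], !![1, 2; 1, 2], !![1, 0; 2, 0], !![0, 1; 0, 2], !![1, 1; 2, 2]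
* `K13` = !![1, 1; 1, 2], !![1, 2; 2, 0], !![1, 2; 1, 1], !![1, 0; 2, 1], !![0, 1; 1, 2], !![1, 1; 2, 0], !![1, 0; 1, 1], !![0, 1; 2, 0], !![1, 1; 0, 2], !![1, 1; 1, 0], !![1, 2; 0, 1], !![1, 0; 2, 2], !![0, 1; 2, 2], !![1, 0; 0, 2], !![0, 1; 0, 0], !![1, 1; 0, 0], !![1, 2; 0, 0], !![0, 0; 0, 1], !![0, 0; 1, 1], !![0, 0; 1, 2], !![1, 0; 1, 0], !![0, 1; 0, 1], !![1, 2; 1, 2], !![0, 1; 0, 2], !![1, 1; 2, 2], !![1, 1; 2, 2], !![1, 2; 2, 1]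
* `K14` = !![1, 2; 2, 0], !![1, 1; 0, 1], !![1, 2; 1, 1], !![1, 0; 2, 1], !![1, 1; 2, 0], !![1, 2; 0, 2], !![1, 0; 1, 1], !![1, 2; 2, 2], !![1, 1; 1, 0], !![1, 2; 0, 1], !![1, 0; 2, 2], !![1, 1; 2, 1], !![1, 2; 1, 0], !![1, 0; 0, 2], !![1, 0; 0, 0], !![0, 1; 0, 0], !![1, 1; 0, 0], !![1, 2; 0, 0], !![0, 0; 1, 0], !![0, 0; 0, 1], !![0, 0; 1, 1], !![1, 0; 1, 0], !![0, 1; 0, 1], !![1, 1; 1, 1], !![1, 2; 1, 2], !![1, 0; 2, 0], !![1, 1; 2, 2]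
* `K15` = !![1, 1; 0, 1], !![1, 2; 1, 1], !![1, 0; 2, 1], !![1, 1; 2, 0], !![1, 2; 0, 2], !![1, 0; 1, 1], !![0, 1; 2, 0], !![1, 1; 0, 2], !![1, 0; 1, 2], !![0, 1; 2, 1], !![1, 2; 0, 1], !![1, 0; 2, 2], !![0, 1; 2, 2], !![1, 1; 2, 1], !![1, 2; 1, 0], !![0, 1; 0, 0], !![1, 1; 0, 0], !![1, 2; 0, 0], !![0, 0; 1, 0], !![0, 0; 1, 1], !![0, 0; 1, 2], !![1, 0; 1, 0], !![0, 1; 0, 1], !![1, 2; 1, 2], !![1, 0; 2, 0], !![0, 1; 0, 2], !![1, 1; 2, 2]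
(terms listed as `!![u₀₀, u₀₁; u₁₀, u₁₁]`, i.e. `REP827 j i = clsM (repCls827L[j][i])`; tensor g39's kill list `K1–K15`) is the X-marginal of a
`27`-term `𝔽₃`-computation of `⟨2,2,8⟩` — the EXCLUSION hypothesis, NOT proved in the tree — THEN `R_𝔽₃(⟨2,2,8⟩) = 28` (kernel floor `27`,
Hopcroft–Kerr ceiling `28`). -/
theorem tensorRank_228_gf3_eq_of_exclusion
    (hexcl : ∀ j, j < 15 → ∀ β : BilinComp (mulBilin (ZMod 3) 2 2 8) (Fin 27), xMarginal β ≠ REP827 j) :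
    tensorRank (matMulTensor (ZMod 3) 2 2 8) = 28 := by
  classical
  refine tensorRank_228_gf3_eq_of_noLoadedPlane fun β hload => ?_
  obtain ⟨j, hj, w, hw, he⟩ := cover827 _ (adm827_cnt β hload)
  obtain ⟨hR0, hRc⟩ := REP827_facts j hj
  have hr : 27 ≤ tensorRank (matMulTensor (ZMod 3) 2 2 8) := by
    have h := (tensorRank_matMulTensor_22n_gf3_window 8 (by norm_num)).1
    have h' : max (3 * 8 + 2) ((36 * 8 + 10) / 11) = 27 := by norm_num
    omega
  have hm : ∀ i, xMarginal β i ≠ 0 := xMarginal_ne_zero_of_le_tensorRank hr β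
  have hM0 := moveW_ne_zero w hw (REP827 j) hR0
  have hcnt : Eq40 (cnt (moveW w (REP827 j))) (cnt (xMarginal β)) := fun b hb => by
    rw [cnt_moveW w hw (REP827 j) b hb, actWS_congr w hw hRc b hb, ← he b hb]
  have horb : InOrbit (xMarginal β) (REP827 j) :=
    ((inOrbit_moveW w hw (REP827 j)).trans (inOrbit_of_cnt_eq _ _ hM0 hm hcnt)).symm
  obtain ⟨β', hβ'⟩ := exists_xMarginal_eq_of_inOrbit β horb
  exact hexcl j hj β' hβ'

end Summit.MatrixMultiplication.OmegaCensus.SmallFormats.Cover827
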